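import Mathlib
import HarnessLib
import Literature.NumberTheory.Automorphic.WeightOneDescent
import Literature.NumberTheory.Automorphic.CuspFormsBoundedHC
import Literature.NumberTheory.Automorphic.HyperbolicLaplaceSpectrum
import Summits.Langlands.Langlands.Theorems.QuarterDeficit1951CorrespondentFingerprintStubDescentAux1

/-!
# Crux `CorrespondentFingerprint` (stmt-Langlands-15898), line `Sketch`, stub `stub_descent`:
# auxiliary file 2 — the archimedean (algebraic and smooth) part of the weight-`0` descent

For a cusp form `φ₀` on `GL₂(𝔸_ℚ)` which is `K₁(N)`-fixed, has central character `ψ_{χ₁}`, is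
`A_G`-invariant, archimedean-smooth, of `SO(2)`-weight `0` along `ι_𝔸 : GL₂(ℝ) → GL₂(𝔸_ℚ)` and
killed by `Z`, the classical function `u(τ) = φ₀((g_τ, 1))`, `g_τ = (y x; 0 1)`, satisfies:
`φ₀((g, 1)) = u(g · i)` for `det g > 0` (weight `0`: right invariance under `ℝ_{>0} SO(2)`),
`u(γ τ) = χ₁(d) u(τ)` for `γ ∈ Γ₀(N)` (left `GL₂(ℚ)`-invariance and the nebentypus identity of
auxiliary file 1), `u` is smooth (`IsC2`), bounded (`cuspidal_bounded_holds`) and non-zero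
(`GL₂(𝔸_ℚ) = GL₂(ℚ)(GL₂(ℝ)⁺ × K₁(N))`).  Registered sub-goal `stub_descent_arch`.
Theorems only; no `sorry`.
-/

set_option linter.dupNamespace false

noncomputable section

open scoped MatrixGroups Matrix NumberField ContDiff Topology Classical
open Literature.NumberTheory.Automorphic Literature.NumberTheory.GaloisRepresentations
  IsDedekindDomain NumberField
open Literature.NumberTheory.Automorphic.GL2Real
open Filter UpperHalfPlane

namespace Summit.Langlands.Langlands.Theorems.CorrespondentFingerprint

/-! ### Weight `0`: right invariance under `ℝ_{>0} SO(2)` -/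

section WeightZero

variable {G : Type*} [Group G] {j : GL (Fin 2) ℝ →* G}

/-- **Weight zero and `Z ψ = 0` give right invariance under the stabiliser of `i`**
(`HasArchWeight 0`) for every pull-back `F = ψ(a · j(·))` of a function `ψ` of `SO(2)`-weight `0`
along `j`, archimedean-smooth and killed by `Z` (the weight-`0` twin of
`hasArchWeight_one_of_isWeightVec`). [cite: Gelbart1997, (2.5.4) (iii)–(iv)] -/
theorem hasArchWeight_zero_of_isWeightVec {ψ : G → ℂ} (hw : IsWeightVec (inclOf j) 0 ψ)
    (hs : IsArchSmooth (inclOf j) ψ) (hZ : lieDeriv (inclOf j) (toLie 1) ψ = 0) (a : G) :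
    HasArchWeight 0 fun y => ψ (a * j y) := by
  refine hasArchWeight_of_rotGL_of_realScalarGL (fun g θ _ => ?_) (fun g r hr _ => ?_)
  · have h := hw (-θ) (a * j g)
    have hk : inclOf j (rotK (-θ)) = j (rotGL θ) := by
      change j (rotGL (-(-θ))) = _; rw [neg_neg]
    rw [hk, mul_assoc, ← map_mul] at h
    change ψ (a * j (g * rotGL θ)) = ψ (a * j g) * _
    rw [h, neg_zero, zpow_zero, mul_one, Int.cast_zero, zero_mul, zero_mul, Complex.exp_zero, one_mul]
  · rw [map_mul, ← mul_assoc]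
    exact apply_mul_realScalarGL_of_lieDeriv_one hs hZ _ hr

/-- **A function of weight `0` on `GL₂(ℝ)⁺ is a function of `g · i`**: `F(g) = F(g_{g i})` for
`det g > 0` (`g = g_τ κ` with `τ = g i` and `κ` in the stabiliser `ℝ_{>0} SO(2)` of `i`).
[cite: Gelbart1997, Prop. 2.5 (sketch of proof)] -/
theorem apply_eq_apply_upperHalfPlaneToGL_smul {F : GL (Fin 2) ℝ → ℂ} (hF : HasArchWeight 0 F)
    {g : GL (Fin 2) ℝ} (hg : 0 < g.det.val) : F g = F (upperHalfPlaneToGL (g • UpperHalfPlane.I)) := by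
  set τ : ℍ := g • UpperHalfPlane.I with hτ
  set κ : GL (Fin 2) ℝ := (upperHalfPlaneToGL τ)⁻¹ * g with hκdef
  have e : g = upperHalfPlaneToGL τ * κ := by rw [hκdef, mul_inv_cancel_left]
  have hτpos := det_upperHalfPlaneToGL_pos τ
  have hdet : g.det.val = τ.im * κ.det.val := by
    conv_lhs => rw [e, map_mul, Units.val_mul, det_upperHalfPlaneToGL]
  have hκ : 0 < κ.det.val := by
    have h : 0 < τ.im * κ.det.val := hdet ▸ hg
    exact pos_of_mul_pos_right h τ.im_pos.le
  have hκI : κ • UpperHalfPlane.I = UpperHalfPlane.I := by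
    have h1 : upperHalfPlaneToGL τ • κ • UpperHalfPlane.I = upperHalfPlaneToGL τ • UpperHalfPlane.I := by
      rw [← mul_smul, ← e, upperHalfPlaneToGL_smul_I]
    exact smul_left_cancel _ h1
  conv_lhs => rw [e]
  rw [hF _ _ hτpos hκ hκI, neg_zero, zpow_zero, zpow_zero, mul_one, mul_one]

end WeightZero

/-! ### The classical function `u_φ` of a weight-`0` vector -/

section Descent

variable {hcpt : isCompact_glFiniteIntegralLevel 2 ℚ} {N : ℕ} [NeZero N]
  {φ₀ : (AdelicGroupData.gl 2 ℚ).Adelic → ℂ}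

/-- Left `GL₂(ℚ)`-invariance of an element of the space of cusp forms. [cite: BorelJacquet1979, 4.4] -/
theorem apply_ofGlobal_mul_of_mem_cuspFormsGL (hcusp : φ₀ ∈ cuspFormsGL 2 ℚ hcpt) (γ : GL (Fin 2) ℚ)
    (g : GL (Fin 2) (AdeleRing (𝓞 ℚ) ℚ)) : φ₀ (GLn.ofGlobal 2 ℚ γ * g) = φ₀ g :=
  (isAutomorphicForm_of_mem_automorphicForms_gl (cuspFormsGL_le_automorphicForms 2 ℚ hcpt hcusp)).leftInvariant
    _ ⟨γ, rfl⟩ g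

omit [NeZero N] in
/-- Right `K₁(N)`-invariance, pointwise form. [folklore] -/
theorem apply_mul_ofFinite_of_rightTranslation_eq
    (hK : ∀ u ∈ gammaOneFiniteLevel ℚ (Ideal.span {(N : 𝓞 ℚ)}),
      rightTranslation (AdelicGroupData.gl 2 ℚ) (show (AdelicGroupData.gl 2 ℚ).Adelic from GLn.ofFinite 2 ℚ u) φ₀ = φ₀)
    (h : GL (Fin 2) (FiniteAdeleRing (𝓞 ℚ) ℚ)) (hh : h ∈ gammaOneFiniteLevel ℚ (Ideal.span {(N : 𝓞 ℚ)}))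
    (g : GL (Fin 2) (AdeleRing (𝓞 ℚ) ℚ)) : φ₀ (g * GLn.ofFinite 2 ℚ h) = φ₀ g := by
  have e := congrFun (hK h hh) g
  rw [rightTranslation_apply] at e
  exact e

omit [NeZero N] in
/-- Right invariance under `{1} × K₁(N)` (`gammaOneLevel`), pointwise form. [folklore] -/
theorem apply_mul_of_mem_gammaOneLevel
    (hK : ∀ u ∈ gammaOneFiniteLevel ℚ (Ideal.span {(N : 𝓞 ℚ)}),
      rightTranslation (AdelicGroupData.gl 2 ℚ) (show (AdelicGroupData.gl 2 ℚ).Adelic from GLn.ofFinite 2 ℚ u) φ₀ = φ₀)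
    {u : GL (Fin 2) (AdeleRing (𝓞 ℚ) ℚ)} (hu : u ∈ gammaOneLevel ℚ (Ideal.span {(N : 𝓞 ℚ)}))
    (g : GL (Fin 2) (AdeleRing (𝓞 ℚ) ℚ)) : φ₀ (g * u) = φ₀ g := by
  rw [mem_gammaOneLevel_iff] at hu
  have e : u = GLn.ofFinite 2 ℚ (GLn.sndHom 2 ℚ u) :=
    GLn.ext_of_fstHom_of_sndHom (by rw [GLn.fstHom_ofFinite, hu.1]) (by rw [GLn.sndHom_ofFinite])
  rw [e]
  exact apply_mul_ofFinite_of_rightTranslation_eq hK _ hu.2 g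

/-- The central character, pointwise form. [folklore] -/
theorem apply_mul_scalar_of_rightTranslation_eq (χ₁ : DirichletCharacter ℂ N)
    (hcen : ∀ z : ideleGroup ℚ,
      rightTranslation (AdelicGroupData.gl 2 ℚ) (Matrix.GeneralLinearGroup.scalar (Fin 2) z) φ₀ =
        ((HeckeCharacter.ofDirichlet χ₁ z : ℂˣ) : ℂ) • φ₀)
    (z : ideleGroup ℚ) (g : GL (Fin 2) (AdeleRing (𝓞 ℚ) ℚ)) :
    φ₀ (g * Matrix.GeneralLinearGroup.scalar (Fin 2) z) = ((HeckeCharacter.ofDirichlet χ₁ z : ℂˣ) : ℂ) * φ₀ g := by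
  have e := congrFun (hcen z) g
  rw [rightTranslation_apply, Pi.smul_apply, smul_eq_mul] at e
  exact e

/-- **The archimedean part `F(g) = φ₀((g, 1))` of a weight-`0`, `Z`-killed vector has weight `0`.**
[cite: Gelbart1997, (2.5.4) (iii)–(iv)] -/
theorem hasArchWeight_zero_ofRealGL (hs : IsArchSmooth Rat.iotaA φ₀) (hw : IsWeightVec Rat.iotaA 0 φ₀)
    (hZ : lieDeriv Rat.iotaA (toLie 1) φ₀ = 0) :
    HasArchWeight 0 fun x : GL (Fin 2) ℝ => φ₀ (Rat.ofRealGL 2 x) := by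
  have hpull : (fun x : GL (Fin 2) ℝ => φ₀ (Rat.ofRealGL 2 x)) = fun y => φ₀ (1 * Rat.ofRealGLA y) := by
    funext y; rw [one_mul]; rfl
  rw [hpull]
  exact hasArchWeight_zero_of_isWeightVec hw hs hZ 1

/-- The archimedean part is archimedean-smooth on `GL₂(ℝ)`. [folklore] -/
theorem isArchSmooth_incl_ofRealGL (hs : IsArchSmooth Rat.iotaA φ₀) :
    IsArchSmooth incl fun x : GL (Fin 2) ℝ => φ₀ (Rat.ofRealGL 2 x) := by
  have hpull : (fun x : GL (Fin 2) ℝ => φ₀ (Rat.ofRealGL 2 x)) = fun y => φ₀ (1 * Rat.ofRealGLA y) := by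
    funext y; rw [one_mul]; rfl
  rw [hpull]
  exact isArchSmooth_incl_of_inclOf hs 1

/-- **`φ₀((g, 1)) = u(g · i)` for `det g > 0`**, `u(τ) = φ₀((g_τ, 1))`. [cite: Gelbart1975, (3.4)] -/
theorem apply_ofRealGL_eq (hs : IsArchSmooth Rat.iotaA φ₀) (hw : IsWeightVec Rat.iotaA 0 φ₀)
    (hZ : lieDeriv Rat.iotaA (toLie 1) φ₀ = 0) {g : GL (Fin 2) ℝ} (hg : 0 < g.det.val) :
    φ₀ (Rat.ofRealGL 2 g) = φ₀ (Rat.ofRealGLA (upperHalfPlaneToGL (g • UpperHalfPlane.I))) :=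
  apply_eq_apply_upperHalfPlaneToGL_smul (hasArchWeight_zero_ofRealGL hs hw hZ) hg

/-- **Automorphy of `u` with nebentypus**: `u(γ τ) = χ₁(d) u(τ)` for `γ = (a b; c d) ∈ Γ₀(N)`.
[cite: Gelbart1975, (3.5), Prop. 3.1] -/
theorem descent_slash (χ₁ : DirichletCharacter ℂ N) (hcusp : φ₀ ∈ cuspFormsGL 2 ℚ hcpt)
    (hK : ∀ u ∈ gammaOneFiniteLevel ℚ (Ideal.span {(N : 𝓞 ℚ)}),
      rightTranslation (AdelicGroupData.gl 2 ℚ) (show (AdelicGroupData.gl 2 ℚ).Adelic from GLn.ofFinite 2 ℚ u) φ₀ = φ₀)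
    (hcen : ∀ z : ideleGroup ℚ,
      rightTranslation (AdelicGroupData.gl 2 ℚ) (Matrix.GeneralLinearGroup.scalar (Fin 2) z) φ₀ =
        ((HeckeCharacter.ofDirichlet χ₁ z : ℂˣ) : ℂ) • φ₀)
    (hs : IsArchSmooth Rat.iotaA φ₀) (hw : IsWeightVec Rat.iotaA 0 φ₀) (hZ : lieDeriv Rat.iotaA (toLie 1) φ₀ = 0)
    (γ : SL(2, ℤ)) (hγ : γ ∈ CongruenceSubgroup.Gamma0 N) (τ : ℍ) :
    φ₀ (Rat.ofRealGLA (upperHalfPlaneToGL (γ • τ))) =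
      χ₁ (((γ : Matrix (Fin 2) (Fin 2) ℤ) 1 1 : ℤ) : ZMod N) * φ₀ (Rat.ofRealGLA (upperHalfPlaneToGL τ)) := by
  have hdet : 0 < (Matrix.SpecialLinearGroup.mapGL ℝ γ * upperHalfPlaneToGL τ).det.val := by
    rw [map_mul, Units.val_mul, Rat.det_mapGL_real, one_mul]; exact det_upperHalfPlaneToGL_pos τ
  have hsmul : (Matrix.SpecialLinearGroup.mapGL ℝ γ * upperHalfPlaneToGL τ) • UpperHalfPlane.I = γ • τ := by
    rw [mul_smul, upperHalfPlaneToGL_smul_I]; rfl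
  have h1 := apply_ofRealGL_eq hs hw hZ hdet
  rw [hsmul] at h1
  rw [← h1]
  exact apply_ofRealGL_gamma0_mul χ₁ (apply_ofGlobal_mul_of_mem_cuspFormsGL hcusp)
    (fun h hh g => apply_mul_ofFinite_of_rightTranslation_eq hK h hh g)
    (apply_mul_scalar_of_rightTranslation_eq χ₁ hcen) hγ (upperHalfPlaneToGL τ)

omit [NeZero N] in
/-- **`u ≠ 0` if `φ₀ ≠ 0`** (`GL₂(𝔸_ℚ) = GL₂(ℚ)(GL₂(ℝ)⁺ × K₁(N))` and `φ₀((g, 1)) = u(g · i)`).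
[cite: Gelbart1975, (3.1), Prop. 3.1] -/
theorem descent_ne_zero (hcusp : φ₀ ∈ cuspFormsGL 2 ℚ hcpt) (hne : φ₀ ≠ 0)
    (hK : ∀ u ∈ gammaOneFiniteLevel ℚ (Ideal.span {(N : 𝓞 ℚ)}),
      rightTranslation (AdelicGroupData.gl 2 ℚ) (show (AdelicGroupData.gl 2 ℚ).Adelic from GLn.ofFinite 2 ℚ u) φ₀ = φ₀)
    (hs : IsArchSmooth Rat.iotaA φ₀) (hw : IsWeightVec Rat.iotaA 0 φ₀) (hZ : lieDeriv Rat.iotaA (toLie 1) φ₀ = 0) :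
    ∃ τ : ℍ, φ₀ (Rat.ofRealGLA (upperHalfPlaneToGL τ)) ≠ 0 := by
  obtain ⟨g, hg⟩ := Function.ne_iff.1 hne
  obtain ⟨γ, hγ⟩ := Rat.exists_ofGlobal_inv_mul_mem_plusLevelOne (Ideal.span {(N : 𝓞 ℚ)})
    (show GL (Fin 2) (AdeleRing (𝓞 ℚ) ℚ) from g)
  set h₀ : GL (Fin 2) (AdeleRing (𝓞 ℚ) ℚ) := (GLn.ofGlobal 2 ℚ γ)⁻¹ * (show GL (Fin 2) (AdeleRing (𝓞 ℚ) ℚ) from g)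
    with hh₀
  have hgh : (show GL (Fin 2) (AdeleRing (𝓞 ℚ) ℚ) from g) = GLn.ofGlobal 2 ℚ γ * h₀ := by rw [hh₀, mul_inv_cancel_left]
  have hdet : 0 < (Rat.archGL 2 h₀).det.val := (Rat.mem_plusLevelOne_iff.1 hγ).1
  have hu : (Rat.ofRealGL 2 (Rat.archGL 2 h₀))⁻¹ * h₀ ∈ gammaOneLevel ℚ (Ideal.span {(N : 𝓞 ℚ)}) :=
    Rat.ofRealGL_archGL_inv_mul_mem_gammaOneLevel hγ
  refine ⟨Rat.archGL 2 h₀ • UpperHalfPlane.I, ?_⟩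
  rw [← apply_ofRealGL_eq hs hw hZ hdet]
  have e : φ₀ g = φ₀ (Rat.ofRealGL 2 (Rat.archGL 2 h₀)) := by
    change φ₀ (show GL (Fin 2) (AdeleRing (𝓞 ℚ) ℚ) from g) = _
    rw [hgh, apply_ofGlobal_mul_of_mem_cuspFormsGL hcusp,
      ← apply_mul_of_mem_gammaOneLevel hK hu (Rat.ofRealGL 2 (Rat.archGL 2 h₀)), mul_inv_cancel_left]
  rw [← e]
  exact hg

/-- **`u` is bounded** (cusp forms invariant under `A_G` are bounded, `cuspidal_bounded_holds`).
[cite: Gelbart1975, Prop. 3.1] -/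
theorem descent_bounded (hcusp : φ₀ ∈ cuspFormsGL 2 ℚ hcpt)
    (hAG : ∀ z ∈ (AdelicGroupData.gl 2 ℚ).center', ∀ g, φ₀ (z * g) = φ₀ g) :
    ∃ C : ℝ, ∀ τ : ℍ, ‖φ₀ (Rat.ofRealGLA (upperHalfPlaneToGL τ))‖ ≤ C := by
  obtain ⟨C, hC⟩ := AutomorphicRepsGL.cuspidal_bounded_holds φ₀ hcusp hAG
  exact ⟨C, fun τ => hC _⟩

end Descent

/-! ### Smoothness of `τ ↦ F(g_τ)` for archimedean-smooth `F` -/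

section Smooth

set_option backward.isDefEq.respectTransparency false in
open scoped Matrix.Norms.Operator in
/-- **The section `τ ↦ F(g_τ)` is smooth** for `F` archimedean-smooth on `GL₂(ℝ)`: near `τ`,
`F(g_z) = Ψ(log(g_τ⁻¹ g_z))` with `Ψ(M) = F(g_τ exp M)` smooth and `log` the smooth local logarithm
(Bump 1997, proof of Prop. 2.2.5). [cite: Bump1997, Prop. 2.2.5 (proof)] -/
theorem contDiffAt_comp_upperHalfPlaneToGL {F : GL (Fin 2) ℝ → ℂ} (hs : IsArchSmooth incl F) (τ : ℍ) :
    ContDiffAt ℝ ∞ (fun z : ℂ => F (upperHalfPlaneToGL (ofComplex z))) (τ : ℂ) := by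
  set g₀ : GL (Fin 2) ℝ := upperHalfPlaneToGL τ with hg₀
  set Ψ : Matrix (Fin 2) (Fin 2) ℝ → ℂ := fun M => F (g₀ * expGL M) with hΨ_def
  have hΨ : ContDiff ℝ ∞ Ψ := contDiff_slice hs g₀
  obtain ⟨log, hlogC, hlog1, hright, -⟩ := exists_contDiffAt_log_inverse (A := ℝ) (N := Fin 2)
  set h : ℂ → Matrix (Fin 2) (Fin 2) ℝ :=
    fun z => ((g₀⁻¹ : GL (Fin 2) ℝ) : Matrix (Fin 2) (Fin 2) ℝ) * secMat z with hh_def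
  have hhd : HasFDerivAt h (((g₀⁻¹ : GL (Fin 2) ℝ) : Matrix (Fin 2) (Fin 2) ℝ) • secMatDeriv) (τ : ℂ) :=
    (hasFDerivAt_secMat (τ : ℂ)).const_mul _
  have hhC : ContDiff ℝ ∞ h := by
    have h1 : ContDiff ℝ ∞ secMat := by
      have e : secMat = fun w : ℂ => w.im • e₁₁ + w.re • e₁₂ + e₂₂ := funext fun w => secMat_eq w
      rw [e]
      exact ((Complex.imCLM.contDiff.smul contDiff_const).add (Complex.reCLM.contDiff.smul contDiff_const)).add
        contDiff_const
    exact contDiff_const.mul h1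
  have hh1 : h τ = 1 := by
    simp only [hh_def, ← coe_upperHalfPlaneToGL, ← hg₀, ← Units.val_mul, inv_mul_cancel, Units.val_one]
  have hcont : Tendsto h (𝓝 (τ : ℂ)) (𝓝 1) := by
    rw [← hh1]; exact hhd.continuousAt
  have hev : (fun z : ℂ => F (upperHalfPlaneToGL (ofComplex z))) =ᶠ[𝓝 (τ : ℂ)]
      fun z => Ψ (log (h z)) := by
    filter_upwards [hcont.eventually hright, isOpen_upperHalfPlaneSet.mem_nhds τ.im_pos] with z hz hzim
    rw [ofComplex_apply_of_im_pos hzim]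
    simp only [hΨ_def]
    congr 1
    refine Units.ext ?_
    rw [Units.val_mul, coe_expGL, hz, hh_def]
    dsimp only
    rw [Units.mul_inv_cancel_left]
    rfl
  refine ContDiffAt.congr_of_eventuallyEq ?_ hev
  have hlog' : ContDiffAt ℝ ∞ log (h τ) := by rw [hh1]; exact hlogC
  exact hΨ.contDiffAt.comp (τ : ℂ) (hlog'.comp (τ : ℂ) hhC.contDiffAt)

/-- **`τ ↦ F(g_τ)` is `C²` on `ℍ`** (`IsC2`) for `F` archimedean-smooth on `GL₂(ℝ)`. [folklore] -/
theorem isC2_comp_upperHalfPlaneToGL {F : GL (Fin 2) ℝ → ℂ} (hs : IsArchSmooth incl F) :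
    IsC2 fun τ : ℍ => F (upperHalfPlaneToGL τ) := by
  intro z hz
  have hz' : 0 < z.im := hz
  have h : ContDiffAt ℝ 2 (fun z : ℂ => F (upperHalfPlaneToGL (ofComplex z))) z :=
    (contDiffAt_comp_upperHalfPlaneToGL hs ⟨z, hz'⟩).of_le (by norm_cast)
  exact h.contDiffWithinAt

/-- **`τ ↦ F(g_τ)` is continuous on `ℍ`** for `F` archimedean-smooth on `GL₂(ℝ)`. [folklore] -/
theorem continuous_comp_upperHalfPlaneToGL {F : GL (Fin 2) ℝ → ℂ} (hs : IsArchSmooth incl F) :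
    Continuous fun τ : ℍ => F (upperHalfPlaneToGL τ) := by
  have h : (fun τ : ℍ => F (upperHalfPlaneToGL τ)) =
      (fun z : ℂ => F (upperHalfPlaneToGL (ofComplex z))) ∘ ((↑) : ℍ → ℂ) := by
    funext τ
    rw [Function.comp_apply, ofComplex_apply]
  rw [h]
  refine continuous_iff_continuousAt.2 fun τ => ?_
  exact (contDiffAt_comp_upperHalfPlaneToGL hs τ).continuousAt.comp UpperHalfPlane.continuous_coe.continuousAt

end Smooth

/-! ### Assembly of the archimedean part -/

section Assembly

/-- **Registered sub-goal `stub_descent_arch` of `stub_descent`**: for a non-zero cusp form `φ₀`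
on `GL₂(𝔸_ℚ)`, `K₁(N)`-fixed, of central character `ψ_{χ₁}`, `A_G`-invariant, archimedean-smooth,
of `SO(2)`-weight `0` and killed by `Z`, the function `u(τ) = φ₀((g_τ, 1))` is `C²`, satisfies
`u(γ τ) = χ₁(d) u(τ)` on `Γ₀(N)`, is non-zero, bounded and continuous.
[cite: Gelbart1975, §3.A, Prop. 3.1] -/
theorem stub_descent_arch : ∀ (hcpt : isCompact_glFiniteIntegralLevel 2 ℚ) (N : ℕ) [NeZero N] (χ₁ : DirichletCharacter ℂ N) (φ₀ : (AdelicGroupData.gl 2 ℚ).Adelic → ℂ), φ₀ ∈ cuspFormsGL 2 ℚ hcpt → φ₀ ≠ 0 → (∀ u ∈ gammaOneFiniteLevel ℚ (Ideal.span {(N : 𝓞 ℚ)}), rightTranslation (AdelicGroupData.gl 2 ℚ) (show (AdelicGroupData.gl 2 ℚ).Adelic from GLn.ofFinite 2 ℚ u) φ₀ = φ₀) → (∀ z : ideleGroup ℚ, rightTranslation (AdelicGroupData.gl 2 ℚ) (Matrix.GeneralLinearGroup.scalar (Fin 2) z) φ₀ = ((HeckeCharacter.ofDirichlet χ₁ z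 : ℂˣ) : ℂ) • φ₀) → (∀ z ∈ (AdelicGroupData.gl 2 ℚ).center', ∀ g, φ₀ (z * g) = φ₀ g) → IsArchSmooth Rat.iotaA φ₀ → IsWeightVec Rat.iotaA 0 φ₀ → lieDeriv Rat.iotaA (toLie 1) φ₀ = 0 → IsC2 (fun τ : UpperHalfPlane => φ₀ (Rat.ofRealGLA (upperHalfPlaneToGL τ))) ∧ (∀ γ : Matrix.SpecialLinearGroup (Fin 2) ℤ, γ ∈ CongruenceSubgroup.Gamma0 N → ∀ z : UpperHalfPlane, φ₀ (Rat.ofRealGLA (upperHalfPlaneToGL (γ • z))) = χ₁ ((γ 1 1 : ℤ) : ZMod N) * φ₀ (Rat.ofRealGLA (upperHalfPlaneToGL z))) ∧ (∃ z : UpperHalfPlane, φ₀ (Rat.ofRealGLA (upperHalfPlaneToGL z)) ≠ 0) ∧ (∃ C : ℝ, ∀ z : UpperHalfPlane, ‖φ₀ (Rat.ofRealGLA (upperHalfPlaneToGL z))‖ ≤ C) ∧ Continuous (fun τ : UpperHalfPlane => φ₀ (Rat.ofRealGLA (upperHalfPlaneToGL τ))) := by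
  intro hcpt N _ χ₁ φ₀ hcusp hne hK hcen hAG hs hw hZ
  have hsm : IsArchSmooth incl fun x : GL (Fin 2) ℝ => φ₀ (Rat.ofRealGL 2 x) := isArchSmooth_incl_ofRealGL hs
  refine ⟨isC2_comp_upperHalfPlaneToGL hsm, fun γ hγ z => descent_slash χ₁ hcusp hK hcen hs hw hZ γ hγ z,
    descent_ne_zero hcusp hne hK hs hw hZ, descent_bounded hcusp hAG, continuous_comp_upperHalfPlaneToGL hsm⟩

end Assembly

end Summit.Langlands.Langlands.Theorems.CorrespondentFingerprint
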